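import Summits.QuantumAdvantage.QuantumAdvantage.Theses.CubicForrelation
import Literature.Computability.QuantumComplexity.ForrelationSignTransport

/-!
# Crux `CubicForrelation.ExactPairsMaioranaMcFarland` (stmt-QuantumAdvantage-2205) — stub `stub_dual_of_forrelation`

Line `two-adic-local-nongeneric`, stub `stub_dual_of_forrelation` (the bridge used first in the
composition `ExactPairsMaioranaMcFarland_of`): on `n = m + m` bits, `forrelation f g = 1` forces `g` to
be BENT with dual exactly `f`, i.e. the unnormalised Walsh transform of `(-1)^g` satisfies

  `W_g(b) = Σ_x (-1)^{g(x)} (-1)^{x·b} = 2^m · (-1)^{f(b)}`   for every `b`.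

Informally: `Φ(f,g) = 2^{-3n/2} Σ_b (-1)^{f(b)} W_g(b)`, Parseval gives `Σ_b W_g(b)² = 2^{2n}`, so
`Φ = 1` is the Cauchy–Schwarz equality case `Σ_b (W_g(b) - 2^{n/2} (-1)^{f(b)})² = 0` (Rothaus;
Aaronson–Ambainis 2018, §1.1.1; Dutta–Maitra–Mukherjee 2024, §3).

Proof: everything is in the tree (`Literature/Computability/QuantumComplexity/ForrelationSignTransport`,
namespace `DerivativeWalsh`): `two_pow_mul_W_eq` gives `2ⁿ · W_g(b) = S(f,g) · (-1)^{f(b)}` once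
`S(f,g)² = 8ⁿ` (`fsum_signOf_sq_of_forrelation_sq` from `Φ² = 1`), and `S(f,g) = √(2^{3n}) · Φ =
2ⁿ · √(2ⁿ)` (`fsum_signOf_eq`, `sqrt_two_pow_three_mul`); cancel `2ⁿ > 0` and use `√(2^{m+m}) = 2^m`.

What is NOT here: the converse (a bent `g` with dual `f` has `Φ(f,g) = 1`), any degree hypothesis
(this bridge is degree-free), and the other four stubs of the line.
-/

set_option linter.dupNamespace false -- D-0017: single-problem summit ⇒ `QuantumAdvantage.QuantumAdvantage` by design

namespace Summit.QuantumAdvantage.QuantumAdvantage.Theorems.CubicForrelation.ExactPairsMaioranaMcFarland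

open Literature.Computability.QuantumComplexity
open Literature.Computability.QuantumComplexity.BuzetChailloux (bxor)
open Literature.Computability.QuantumComplexity.BuzetChailloux (signOf_sq)
open Literature.Computability.QuantumComplexity.DerivativeWalsh (two_pow_mul_W_eq fsum_signOf_eq
  fsum_signOf_sq_of_forrelation_sq sqrt_two_pow_three_mul)

/-- `√(2^{m+m}) = 2^m`. -/
theorem dof_sqrt_two_pow_add_self (m : ℕ) : Real.sqrt ((2 : ℝ) ^ (m + m)) = (2 : ℝ) ^ m := by
  rw [pow_add, Real.sqrt_mul_self (by positivity)]

/-- **Exact forrelation forces bentness with dual `f`.** On `m + m` bits, `forrelation f g = 1` implies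
`W_g(b) = Σ_x (-1)^{g(x) + x·b} = 2^m · (-1)^{f(b)}` for every `b` (Parseval + Cauchy–Schwarz equality;
Aaronson–Ambainis 2018 §1.1.1, Dutta–Maitra–Mukherjee 2024 §3). -/
theorem stub_dual_of_forrelation :
    ∀ (m : ℕ) (f g : (Fin (m + m) → Bool) → Bool), forrelation f g = 1 →
      ∀ b : Fin (m + m) → Bool,
        DerivativeWalsh.W (fun x => signOf (g x)) b = (2 : ℝ) ^ m * signOf (f b) := by
  intro m f g h b
  have key := two_pow_mul_W_eq (fun x => signOf (f x)) (fun y => signOf (g y))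
    (fun x => signOf_sq (f x)) (fun y => signOf_sq (g y))
    (fsum_signOf_sq_of_forrelation_sq f g (by rw [h]; norm_num)) b
  rw [fsum_signOf_eq, h, mul_one, sqrt_two_pow_three_mul, dof_sqrt_two_pow_add_self, mul_assoc] at key
  exact mul_left_cancel₀ (by positivity : (2 : ℝ) ^ (m + m) ≠ 0) key

end Summit.QuantumAdvantage.QuantumAdvantage.Theorems.CubicForrelation.ExactPairsMaioranaMcFarland
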